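import Summits.BirchSwinnertonDyer.Uniform.U2.CubicFieldInertOddTrace
import Summits.BirchSwinnertonDyer.Uniform.U2.RouteBAssembly
import Summits.BirchSwinnertonDyer.Rank1Residual.P2.CountsAtTwoZhai16Erratum
import HarnessLib

/-!
# Track U2 (cell `bsd-uniform`, seat u2-p1): the rank-`0` member's ZHAI UNIT and REGULATOR from
# Zhai 2016 Thm 1.1 / 1.2 AS CORRECTED (named facts) + PER-BASE data on `E^{(D)}`

HONEST FRAMING (cell `bsd-uniform`, HOME run/shared/lean/pub/bsd-uniform/, verbatim in every file of
the seat): a RELATIVE ("twist-transport") theorem, uniform in the twisting parameter `d`, CONDITIONAL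
on NAMED PUBLISHED FACTS taken BY NAME (here Zhai 2016 Thm 1.1 / 1.2 AS CORRECTED — arXiv v2: odd
Manin constant — `Zhai2016.thm11_ordTwo_LAlg_twist_eq_zero'` / `thm12_ordTwo_LAlg_twist_eq_one'`,
and `L(E, s)` entire) and on PER-BASE binders of `E₀ = E^{(D)}` (model `W₀`): optimal
parametrisation datum with odd Manin constant (`Dt₀`, `hopt₀`, `hν₀`), `r_an(E₀) = 0`, `BSD(E₀, 2)`,
`Ш(E₀)[2] = 0`, (H-2) `E₀(ℚ)[2] = 0`, `c(E₀)` odd — and the cell's ARITHMETIC class condition on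
`(E₀, d)` (`d ≡ 1 (mod 4)` square-free `≠ 1`, prime to `N(E₀)`, every `q ∣ d` good with `a_q(E₀)`
odd, `d > 0` if `Δ(E₀) > 0`). It converts PAIRS, never the class X5; books nothing; moves no census
number; no per-curve certificate is counted as a uniform theorem.

WHAT THIS FILE DOES. The U2 end-to-end heads (`bsdp_two_of_genusTheory_oneH2`, `…_split`,
`…_split_base`, …) carry, for the RANK-`0` member `W₂ ≅ E^{(dD)} = E₀^{(d)}` of the genus pair, the
PER-TWIST-PAIR binders `hZhai` (`L(W₂,1)/Ω(W₂)` is a non-zero rational `2`-adic unit) and `hReg₂`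
(`Reg(W₂) = 1`). HERE both are DERIVED, for a globally minimal model `W₂` of `E₀^{(d)}`, from the
named facts and the per-base binders above:

1. `exists_isLAlg_of_bsdp_two` — PER BASE: `r_an(E₀) = 0`, `BSD(E₀, 2)`, `Ш(E₀)[2] = 0`,
   `E₀(ℚ)[2] = 0`, `c(E₀)` odd ⟹ Zhai's hypothesis `ord₂(L(E₀,1)/Ω_∞(E₀)) = ord₂ c_∞(E₀)` (`= 0` for
   `Δ < 0`, `= 1` for `Δ > 0`; `Ω_BSD = c_∞ · Ω_∞`): Miller's `#Ш_an(E₀) = L·T²/(Ω·c·Reg)` has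
   `2`-adic valuation `ord₂ #Ш(E₀)[2^∞] = 0`, `Reg = 1`, `T` and `c` odd.
2. `rankZero_twist_of_zhai'` — with the cubic `2`-division field and Zhai's «inert» binder SUPPLIED
   by `CubicFieldInertOddTrace.lean` (`exists_isTwoDivisionField`, `forall_isInertIn_of_oddTrace`:
   `a_q` odd ⟹ `q` inert in `F`), Zhai Thm 1.1' (`Δ(E₀) < 0`) / Thm 1.2' (`Δ(E₀) > 0`, `d > 0`) give
   `ord₂(L(W₂,1)/Ω_∞(W₂)) = ord₂ c_∞`, `L(W₂, 1) ≠ 0`, `W₂(ℚ)` and `Ш(W₂)` finite; hence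
   `r_an(W₂) = 0` (`analyticRank_eq_zero_iff`), `rank W₂(ℚ) = 0` (finite Mordell–Weil group — NO
   GZK input), `Reg(W₂) = 1`, and the ZHAI UNIT `L(W₂,1) = q · Ω(W₂)`, `q = x / c_∞`, `ord₂ q = 0`.

So on the U2 heads the per-twist-pair binders `hZhai` / `hReg₂` become: TWO NAMED FACTS (Zhai 1.1',
1.2') + PER-BASE (`Dt₀` optimal with odd Manin constant, `hc₀`) + class condition (`hgcd₀`) — see
`GenusTheoryEndToEndZhai.lean`. What this file is NOT: it proves none of the named facts; Zhai's
theorems are analytic-rank-ZERO statements about OPTIMAL curves (the restriction «`E^{(D)}` is the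
`Γ₀(N₀)`-optimal curve of its isogeny class» is a genuine per-base hypothesis); nothing is booked.

## Contents (theorems only; no `def`, no named fact)
* `natCard_twoTorsionSubtype_eq_one_of_forall`, `natAbs_primeFactors_nonempty` — bookkeeping.
* `exists_isLAlg_of_bsdp_two` — (1).
* **`rankZero_twist_of_zhai'`** — (2).

References: S. Zhai, Asian J. Math. 20 (2016) 475–502 Thm 1.1 / 1.2 and arXiv:1409.0231v2 (2017)
Thm 1.1 / 1.3 with the standing assumption [Zhai2016]; R. L. Miller, LMS J. Comput. Math. 14 (2011)
Def. 1.1 [Miller2011LMS]; J. H. Silverman, *AEC* 2nd ed. (2009) [SilvermanAEC2009].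
-/

noncomputable section

open scoped Classical

open NumberField WeierstrassCurve Literature.NumberTheory.EllipticCurves
  Literature.NumberTheory.EllipticCurves.ModularForms
  Literature.NumberTheory.EllipticCurves.Rank1Residual
  Literature.NumberTheory.EllipticCurves.CoatesLiTianZhai2015
  Literature.NumberTheory.EllipticCurves.Zhai2016
  Summit.BirchSwinnertonDyer.Rank1Residual

namespace Summit.BirchSwinnertonDyer.Uniform.U2

/-! ## §1 Bookkeeping -/

/-- `A[2] = 0` elementwise ⇒ `#{P : A // 2 • P = 0} = 1` (Zhai's binder "`E[2](ℚ) = 0`" in the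
tree's count form). [folklore] -/
theorem natCard_twoTorsionSubtype_eq_one_of_forall {A : Type*} [AddCommGroup A]
    (h : ∀ P : A, 2 • P = 0 → P = 0) : Nat.card {P : A // (2 : ℕ) • P = 0} = 1 := by
  rw [Nat.card_eq_one_iff_unique]
  exact ⟨⟨fun a b => Subtype.ext ((h a.1 a.2).trans (h b.1 b.2).symm)⟩, ⟨⟨0, by simp⟩⟩⟩

/-- A square-free `d ≡ 1 (mod 4)` with `d ≠ 1` has a prime factor (`|d| > 1`: `d ∉ {0, 1, −1}`) —
Zhai's binder "`r ≥ 1`". [folklore] -/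
theorem natAbs_primeFactors_nonempty {d : ℤ} (hsqf : Squarefree d) (hd4 : d % 4 = 1) (hd1 : d ≠ 1) :
    d.natAbs.primeFactors.Nonempty := by
  rw [Nat.nonempty_primeFactors]
  have h0 : d ≠ 0 := hsqf.ne_zero
  have hm1 : d ≠ -1 := by
    rintro rfl
    omega
  omega

/-! ## §2 PER BASE: `BSD(E₀, 2)` & co. ⟹ Zhai's hypothesis `ord₂(L(E₀,1)/Ω_∞(E₀)) = ord₂ c_∞(E₀)` -/

/-- **Zhai's base hypothesis from the per-base binders.** For a globally minimal elliptic `W₀ / ℚ`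
with `r_an = 0`, Miller's `BSD(W₀, 2)`, `Ш(W₀)[2] = 0`, `W₀(ℚ)[2] = 0` (count form) and `c(W₀)` odd,
granting `L(E, s)` entire: `L(W₀, 1) = x · Ω_∞(W₀)` with `x ≠ 0` rational and
`ord₂ x = ord₂ c_∞(W₀)` — i.e. `ord₂(L^{(alg)}(E₀, 1)) = 0` when `Δ < 0` (`c_∞ = 1`, Zhai Thm 1.1's
hypothesis) and `= 1` when `Δ > 0` (`c_∞ = 2`, Thm 1.2's). Indeed `#Ш_an = L·T²/(Ω·c·Reg)` is a
rational of valuation `ord₂ #Ш[2^∞] = 0`, `Reg = 1` (rank `0`), `T` odd, `c` odd, `Ω = c_∞ Ω_∞`.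
[cite: Miller2011LMS, Def. 1.1] [cite: Zhai2016, §1 (arXiv:1409.0231 chunk p0002 L12–L18: L^{(alg)})] -/
theorem exists_isLAlg_of_bsdp_two (W₀ : WeierstrassCurve ℚ) [W₀.IsElliptic] [W₀.IsGloballyMinimal]
    (hE : hasEntireLFunction_rat) (hr₀ : W₀.analyticRank = 0) (hbsd₀ : BSDp W₀ 2)
    (hSha₀ : ∀ x : W₀.galH1, x ∈ W₀.sha → 2 • x = 0 → x = 0)
    (h1₀ : Nat.card {P : W₀.toAffine.Point // (2 : ℕ) • P = 0} = 1)
    (hc₀ : Odd W₀.tamagawaProduct) :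
    ∃ x : ℚ, IsLAlg W₀ x ∧ x ≠ 0 ∧
      padicValRat 2 x = padicValNat 2 (W₀.baseChange ℝ).numRealComponents := by
  haveI : Fact (Nat.Prime 2) := ⟨Nat.prime_two⟩
  obtain ⟨hrk, -, q, hq, hv⟩ := hbsd₀
  rw [card_primaryComponent_sha_two_eq_one_of_forall W₀ hSha₀] at hv
  have hv' : padicValRat 2 q = 0 := by simpa using hv
  have hrk0 : W₀.mordellWeilRank = 0 := hrk.trans hr₀
  have hReg : W₀.regulator = 1 := W₀.regulator_eq_one_of_rank_zero hrk0
  have hL : W₀.leadingLCoeff = W₀.entireLFunction 1 := leadingLCoeff_eq_of_analyticRank_eq_zero W₀ hr₀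
  -- odd torsion
  have hirr : Irr W₀ 2 := P2.irr_two_of_card_twoTorsion_eq_one W₀ h1₀
  have htor : padicValNat 2 W₀.torsionOrder = 0 :=
    padicValNat_torsionOrder_eq_zero_of_irreducible W₀ 2 hirr
  have hcv : padicValNat 2 W₀.tamagawaProduct = 0 :=
    padicValNat.eq_zero_of_not_dvd (fun h => (Nat.not_even_iff_odd.2 hc₀) (even_iff_two_dvd.2 h))
  -- positivity
  have hT : (0 : ℕ) < W₀.torsionOrder := W₀.torsionOrder_pos_holds
  have hc : 0 < W₀.tamagawaProduct := W₀.tamagawaProduct_pos'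
  have hΩ : 0 < W₀.realPeriodRat := W₀.realPeriodRat_pos_holds
  have hcinf : 0 < (W₀.baseChange ℝ).numRealComponents :=
    WeierstrassCurve.numRealComponents_pos (W₀.baseChange ℝ)
  have hTC : (W₀.torsionOrder : ℂ) ≠ 0 := by exact_mod_cast hT.ne'
  have hcC : (W₀.tamagawaProduct : ℂ) ≠ 0 := by exact_mod_cast hc.ne'
  have hΩC : (W₀.realPeriodRat : ℂ) ≠ 0 := by exact_mod_cast hΩ.ne'
  have hcinfC : (((W₀.baseChange ℝ).numRealComponents : ℕ) : ℂ) ≠ 0 := by exact_mod_cast hcinf.ne'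
  -- `L(W₀, 1) = q · Ω · c / T²`
  have hLval : W₀.entireLFunction 1 * (W₀.torsionOrder : ℂ) ^ 2 =
      (q : ℂ) * (W₀.realPeriodRat : ℂ) * (W₀.tamagawaProduct : ℂ) := by
    have h := hq
    rw [shaAn_def, hL, hReg] at h
    push_cast at h
    rw [mul_one, div_eq_iff (mul_ne_zero hΩC hcC)] at h
    linear_combination h
  -- `q ≠ 0` because `#Ш_an ≠ 0`
  have hq0 : q ≠ 0 := by
    intro h0
    rw [h0] at hLval
    simp only [Rat.cast_zero, zero_mul] at hLval
    have hLne : W₀.entireLFunction 1 ≠ 0 := by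
      rw [← hL]; exact W₀.leadingLCoeff_ne_zero_holds (hE W₀)
    exact (mul_ne_zero hLne (pow_ne_zero 2 hTC)) hLval
  -- the witness `x = q · c · c_∞ / T²`
  refine ⟨q * W₀.tamagawaProduct * (W₀.baseChange ℝ).numRealComponents / (W₀.torsionOrder : ℚ) ^ 2,
    ?_, ?_, ?_⟩
  · -- `L(W₀,1) = x · Ω_∞`, `Ω_∞ = Ω / c_∞`
    unfold IsLAlg
    rw [leastRealPeriod]
    push_cast
    rw [div_mul_div_comm, eq_div_iff (mul_ne_zero (pow_ne_zero 2 hTC) hcinfC)]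
    linear_combination (((W₀.baseChange ℝ).numRealComponents : ℕ) : ℂ) * hLval
  · have hTq : (W₀.torsionOrder : ℚ) ≠ 0 := by exact_mod_cast hT.ne'
    have hcq : (W₀.tamagawaProduct : ℚ) ≠ 0 := by exact_mod_cast hc.ne'
    have hciq : (((W₀.baseChange ℝ).numRealComponents : ℕ) : ℚ) ≠ 0 := by exact_mod_cast hcinf.ne'
    exact div_ne_zero (mul_ne_zero (mul_ne_zero hq0 hcq) hciq) (pow_ne_zero 2 hTq)
  · have hTq : (W₀.torsionOrder : ℚ) ≠ 0 := by exact_mod_cast hT.ne'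
    have hcq : (W₀.tamagawaProduct : ℚ) ≠ 0 := by exact_mod_cast hc.ne'
    have hciq : (((W₀.baseChange ℝ).numRealComponents : ℕ) : ℚ) ≠ 0 := by exact_mod_cast hcinf.ne'
    rw [padicValRat.div (mul_ne_zero (mul_ne_zero hq0 hcq) hciq) (pow_ne_zero 2 hTq),
      padicValRat.mul (mul_ne_zero hq0 hcq) hciq, padicValRat.mul hq0 hcq, padicValRat.pow,
      padicValRat.of_nat, padicValRat.of_nat, padicValRat.of_nat, hv', hcv, htor]
    push_cast
    ring

/-! ## §3 The rank-`0` member `W₂ ≅ E₀^{(d)}`: `r_an = 0`, rank `0`, `Reg = 1`, Zhai unit -/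

/-- **THE RANK-`0` MEMBER FROM ZHAI 2016 THM 1.1 / 1.2 AS CORRECTED (named facts) + PER-BASE data.**
Let `E₀ / ℚ` be given by a globally minimal `W₀` which is `Γ₀(N₀)`-OPTIMAL with ODD MANIN CONSTANT
(`Dt₀`, `hopt₀ : Zhai2021.IsOptimalDatum W₀ Dt₀`, `hν₀ : 2 ∤ Dt₀.c` — per base; Abbes–Ullmo for odd
`N₀`), with `r_an(E₀) = 0`, `BSD(E₀, 2)`, `Ш(E₀)[2] = 0`, (H-2) `E₀(ℚ)[2] = 0`, `c(E₀)` odd (per base);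
let `d ≡ 1 (mod 4)` be square-free, `d ≠ 1`, prime to `N₀`, every prime `q ∣ d` good for `E₀` with
`a_q(E₀)` odd, and `d > 0` if `Δ(E₀) > 0` (the cell's class condition, arithmetic); let `W₂` be a
globally minimal model of `E₀^{(d)}`. Then, granting Zhai Thm 1.1' (`Δ < 0`) / Thm 1.2' (`Δ > 0`)
and `L(E, s)` entire: `r_an(W₂) = 0`, `rank W₂(ℚ) = 0` (finite Mordell–Weil group; no GZK),
`Reg(W₂) = 1`, the ZHAI UNIT `L(W₂,1) = q · Ω(W₂)` with `q ≠ 0`, `ord₂ q = 0`, and `Ш(W₂)` finite.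
Zhai's binders `F` (cubic `2`-division field) and «`q` inert in `F`» are DISCHARGED from `hT₀` and the
`a_q`-odd condition (`CubicFieldInertOddTrace.lean`); `ord₂ L^{(alg)}(E₀,1) = 0 / 1` from §2.
[cite: Zhai2016, Thm. 1.1 and Thm. 1.2 (arXiv:1409.0231v2 Thm. 1.1 / 1.3, TeX ll. 273–279, 315–321; standing assumption ll. 255–263)]
[cite: Miller2011LMS, Def. 1.1] -/
theorem rankZero_twist_of_zhai' (h11 : thm11_ordTwo_LAlg_twist_eq_zero')
    (h12 : thm12_ordTwo_LAlg_twist_eq_one') (hE : hasEntireLFunction_rat)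
    (W₀ W₂ : WeierstrassCurve ℚ) [W₀.IsElliptic] [W₀.IsGloballyMinimal]
    [NeZero (W₀.conductorNorm ℤ)] [W₂.IsElliptic] [W₂.IsGloballyMinimal]
    -- PER BASE `E₀ = E^{(D)}`: optimal parametrisation with odd Manin constant
    (Dt₀ : ModularParametrizationData W₀ (W₀.conductorNorm ℤ)) (hopt₀ : Zhai2021.IsOptimalDatum W₀ Dt₀)
    (hν₀ : ¬ (2 : ℤ) ∣ Dt₀.c)
    -- PER BASE: `r_an = 0`, `BSD(E₀, 2)`, `Ш(E₀)[2] = 0`, (H-2), `c(E₀)` odd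
    (hr₀ : W₀.analyticRank = 0) (hbsd₀ : BSDp W₀ 2)
    (hSha₀ : ∀ x : W₀.galH1, x ∈ W₀.sha → 2 • x = 0 → x = 0)
    (hT₀ : ∀ P : W₀.toAffine.Point, 2 • P = 0 → P = 0) (hc₀ : Odd W₀.tamagawaProduct)
    -- the class condition on `(E₀, d)`
    {d : ℤ} (hsqf : Squarefree d) (hd4 : d % 4 = 1) (hd1 : d ≠ 1)
    (hgcd₀ : Int.gcd d (W₀.conductorNorm ℤ) = 1)
    (hS₀ : ∀ (q : ℕ), q.Prime → (q : ℤ) ∣ d →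
      ¬ (q : ℤ) ∣ minimalDiscriminantInt W₀ ∧ Odd (W₀.frobeniusTrace q))
    (hreal₀ : 0 < W₀.Δ → 0 < d)
    -- `W₂` a (globally minimal) model of `E₀^{(d)}`
    (h₂' : ∃ C : VariableChange ℚ, C • W₂ = W₀.quadraticTwist (d : ℚ)) :
    W₂.analyticRank = 0 ∧ W₂.mordellWeilRank = 0 ∧ W₂.regulator = 1 ∧
      (∃ q : ℚ, W₂.leadingLCoeff = (q : ℂ) * (W₂.realPeriodRat : ℂ) ∧ q ≠ 0 ∧ padicValRat 2 q = 0) ∧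
      Finite W₂.sha := by
  haveI : Fact (Nat.Prime 2) := ⟨Nat.prime_two⟩
  -- Zhai's binders from the class condition
  obtain ⟨F, _instF, _instNF, hF⟩ := exists_isTwoDivisionField W₀ hT₀
  have hd2 : ¬ (2 : ℤ) ∣ d := by omega
  have hin := forall_isInertIn_of_oddTrace W₀ hF hd2 hS₀
  have hne := natAbs_primeFactors_nonempty hsqf hd4 hd1
  have h1₀ := natCard_twoTorsionSubtype_eq_one_of_forall hT₀
  obtain ⟨x₀, hx₀, hx₀0, hv₀⟩ := exists_isLAlg_of_bsdp_two W₀ hE hr₀ hbsd₀ hSha₀ h1₀ hc₀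
  have hWM : ∃ C : VariableChange ℚ, C • W₀.quadraticTwist (d : ℚ) = W₂ :=
    P2.exists_smul_eq_comm.mp h₂'
  have hd0 : (d : ℚ) ≠ 0 := by exact_mod_cast hsqf.ne_zero
  -- Zhai Thm 1.1' / 1.2' according to the sign of `Δ(E₀)` (`= sign Δ(W₂)`)
  obtain ⟨⟨x, hx, hx0, hv⟩, hL1, hfinPt, hfinSha⟩ :
      (∃ x : ℚ, IsLAlg W₂ x ∧ x ≠ 0 ∧
        padicValRat 2 x = padicValNat 2 (W₂.baseChange ℝ).numRealComponents) ∧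
      W₂.entireLFunction 1 ≠ 0 ∧ Finite W₂.toAffine.Point ∧ Finite W₂.sha := by
    rcases lt_or_gt_of_ne W₀.isUnit_Δ.ne_zero with hΔ | hΔ
    · -- `Δ(E₀) < 0`: `c_∞ = 1`, Thm 1.1'
      have hc₀inf : (W₀.baseChange ℝ).numRealComponents = 1 := P2.numRealComponents_eq_one_of_Δ_neg hΔ
      rw [hc₀inf] at hv₀
      have hv₀' : padicValRat 2 x₀ = 0 := by simpa using hv₀
      obtain ⟨⟨x, hx, hx0, hv⟩, hL1, hfin, hsha⟩ := h11 W₀ Dt₀ hopt₀ hν₀ hΔ h1₀ ⟨x₀, hx₀, hx₀0, hv₀'⟩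
        F hF d hsqf hd4 hgcd₀ hne hin W₂ hWM
      have hΔ₂ : W₂.Δ < 0 := by
        have hnot : ¬ 0 < W₂.Δ := fun h' =>
          absurd ((P2.Δ_pos_iff_of_twist W₀ hd0 hWM).mpr h') (not_lt.mpr hΔ.le)
        exact lt_of_le_of_ne (not_lt.mp hnot) W₂.isUnit_Δ.ne_zero
      have hc₂inf : (W₂.baseChange ℝ).numRealComponents = 1 :=
        P2.numRealComponents_eq_one_of_Δ_neg hΔ₂
      refine ⟨⟨x, hx, hx0, ?_⟩, hL1, hfin, hsha⟩
      rw [hc₂inf, hv]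
      simp
    · -- `Δ(E₀) > 0`: `c_∞ = 2`, `d > 0`, Thm 1.2'
      have hc₀inf : (W₀.baseChange ℝ).numRealComponents = 2 := P2.numRealComponents_eq_two_of_Δ_pos hΔ
      rw [hc₀inf] at hv₀
      have hv₀' : padicValRat 2 x₀ = 1 := by simpa using hv₀
      obtain ⟨⟨x, hx, hx0, hv⟩, hL1, hfin, hsha⟩ := h12 W₀ Dt₀ hopt₀ hν₀ hΔ h1₀ ⟨x₀, hx₀, hx₀0, hv₀'⟩
        F hF d (hreal₀ hΔ) hsqf hd4 hgcd₀ hne hin W₂ hWM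
      have hΔ₂ : 0 < W₂.Δ := (P2.Δ_pos_iff_of_twist W₀ hd0 hWM).mp hΔ
      have hc₂inf : (W₂.baseChange ℝ).numRealComponents = 2 :=
        P2.numRealComponents_eq_two_of_Δ_pos hΔ₂
      refine ⟨⟨x, hx, hx0, ?_⟩, hL1, hfin, hsha⟩
      rw [hc₂inf, hv]
      simp
  -- conclusions: analytic rank, rank, regulator, unit
  have hr : W₂.analyticRank = 0 := (W₂.analyticRank_eq_zero_iff_holds (hE W₂)).2 hL1
  have hrk : W₂.mordellWeilRank = 0 := mordellWeilRank_eq_zero_of_finite W₂ hfinPt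
  have hReg : W₂.regulator = 1 := W₂.regulator_eq_one_of_rank_zero hrk
  have hcinf : 0 < (W₂.baseChange ℝ).numRealComponents :=
    WeierstrassCurve.numRealComponents_pos (W₂.baseChange ℝ)
  have hciq : (((W₂.baseChange ℝ).numRealComponents : ℕ) : ℚ) ≠ 0 := by exact_mod_cast hcinf.ne'
  refine ⟨hr, hrk, hReg, ⟨x / ((W₂.baseChange ℝ).numRealComponents : ℚ), ?_, div_ne_zero hx0 hciq, ?_⟩,
    hfinSha⟩
  · rw [P2.leadingLCoeff_eq_of_isLAlg W₂ hx hr hrk, hReg]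
    push_cast
    ring
  · rw [padicValRat.div hx0 hciq, hv, padicValRat.of_nat]
    ring

end Summit.BirchSwinnertonDyer.Uniform.U2

end
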